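/-
Copyright: the b2b-balaban cell (near-miss cell 7), T⁴-continuum CRUX team (coordinator ruling e34b3e0c item (2)),
seat t4-ne7b-formalise-leaf-01 (gen 28). Released under the licence of the surrounding project.
-/
import Summits.QuantumFields.BalabanUV.T4Continuum.Spine.NE7b.SU2QuaternionBridge
import Summits.QuantumFields.BalabanUV.T4Continuum.Spine.NE7b.NonAbelianStokesReading
import Literature.MathematicalPhysics.QuantumFieldTheory.Balaban1983to89.BlockAveragingSU2

/-!
# (NAS) the lattice non-abelian Stokes INEQUALITY, part 4: the `SU(2)` carrier and its junction with `S³`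
# (route NE7b R-H ∕ C-RH°, `t4/ROUTES-NE7b.md` v7 §1 (NAS): «the bi-invariant size |W − 1| (operator norm on SU(2) ⊂ M₂(ℂ)
# = Euclidean norm on unit quaternions)»)

Cell `pub-balaban`, sub-cell `t4`, spine estimate NE7b (node U5c), candidate route R-H. Parts 1–3 (`NonAbelianStokesBound`
p258024, `NonAbelianStokesReading` p258437, `NonAbelianStokesDisc` p258845) prove (NAS)∕(FF) over any `GaugeGroup`; the cell's
Bałaban files carry `SU(2) = Matrix.specialUnitaryGroup (Fin 2) ℂ` with the tree instance (`dist1 U = ‖U − 1‖`, L²-operator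
norm; `SU2Mean.dist1_eq_norm` in `BlockAveragingSU2`), while the PH-k chain of leaf-06 lives on the unit quaternions
`S³ = Metric.sphere (0 : ℍ) 1` (`SU2QuaternionBridge.su2SphereEquiv : SU(2) ≃* S³`, `toSphereConfig`). THIS FILE is the
junction v7's parenthesis asserts:

* §1 **`dist1_eq_norm_su2SphereEquiv_sub_one`**: `dist1 U = ‖(su2SphereEquiv U : ℍ) − 1‖` — the operator-norm size on
  `SU(2)` IS the Euclidean size on `S³` (chord formula `SU2ChordGeometry.norm_one_sub_coe_sq` `‖1 − U‖² = 2 − Re tr U`, the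
  bridge's `re_trace_su2_eq_two_mul_re`, and `‖q − 1‖² = 2 − 2 re q` for unit `q` — the tree's
  `T4ExpWindowSmallField.norm_sub_one_sq`, inlined); equivalently
  `dist1 U = NonAbelianStokesReading.sphereGaugeGroup.dist1 (su2SphereEquiv U)`;
* §2 `toSphereConfig` commutes with `ZdGaugeConfig.line` and `ZdGaugeConfig.rectangle` (it is a `MulEquiv` linkwise), so
  **(NAS) is ONE inequality on both carriers**, number for number (`dist1_rectangle_eq_norm_toSphereConfig`,
  `sum_dist1_plaquette_eq_sum_norm_toSphereConfig`), and the `SU(2)` statement holds by instance resolution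
  (`su2_dist1_rectangle_le_sum`).

HONEST FRAMING. Bookkeeping between two carriers of ONE configuration; no measure, no constant of [Bałaban 1983–89] asserted or
cited; nothing of bill A∕B, (MP<L²), (JC), (TC). NE7b (`T4WeightBudget.RelWeightBound`) NOT PRINTED, NOT PROVED; spine PROVED 0∕9;
rung (B)+1 on a FINITE torus T⁴ — NOT infinite volume, NOT the mass gap, NOT Clay. HONEST DEPENDENCY: continuum YM on T⁴ ⇐
BetaPertH ∧ nine spine estimates (0/9 proved); BetaPertH ⇐ (D1) ∧ (D4) ∧ CAP+tail; G-an2-4 gates asym, D1 and NE2/3/4. POLICY: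
crux-route work under `Spine/NE7b/` (ROUTES v7 §6's named item (NAS), its `SU(2)` clause; FREEZE (0) respected); 0 definitions, 7 theorems,
no `[cite:]`.
-/

set_option autoImplicit false

namespace Summit.QuantumFields.BalabanUV.T4Continuum.NE7b.NonAbelianStokesSU2

noncomputable section

open scoped Quaternion Matrix.Norms.L2Operator
open Literature.MathematicalPhysics.QuantumFieldTheory (ZdGaugeConfig)
open Literature.MathematicalPhysics.QuantumFieldTheory.Balaban1983to89 (GaugeGroup dist1 SU2Mean.dist1_eq_norm)
open Literature.MathematicalPhysics.QuantumLattice (su2Quat norm_su2Quat)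
open Literature.Computability.QuantumComplexity (norm_one_sub_coe_sq)
open Summit.QuantumFields.BalabanUV.T4Continuum.NE7b.SU2QuaternionBridge
  (su2SphereEquiv coe_su2SphereEquiv re_trace_su2_eq_two_mul_re toSphereConfig plaquette_toSphereConfig)
open Summit.QuantumFields.BalabanUV.T4Continuum.NE7b.NonAbelianStokesReading
  (sphereGaugeGroup sphere_dist1_eq dist1_rectangle_le_sum)

variable {d : ℕ}

/-! ## §1 The two size functions coincide across the bridge -/

/-- **THE JUNCTION**: for `U ∈ SU(2)`, the tree instance's size `dist1 U = ‖U − 1‖` (L²-operator norm on `M₂(ℂ)`) equals the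
Euclidean size `‖su2SphereEquiv U − 1‖` of the corresponding unit quaternion — ROUTES-NE7b v7 (NAS)'s «operator norm on
SU(2) ⊂ M₂(ℂ) = Euclidean norm on unit quaternions» (both squares are `2 − Re tr U`). -/
theorem dist1_eq_norm_su2SphereEquiv_sub_one (U : Matrix.specialUnitaryGroup (Fin 2) ℂ) :
    dist1 U = ‖((su2SphereEquiv U : Metric.sphere (0 : ℍ) 1) : ℍ) - 1‖ := by
  rw [SU2Mean.dist1_eq_norm, coe_su2SphereEquiv]
  have hL : ‖(U : Matrix (Fin 2) (Fin 2) ℂ) - 1‖ ^ 2 = 2 - ((U : Matrix (Fin 2) (Fin 2) ℂ).trace).re := by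
    rw [norm_sub_rev]; exact norm_one_sub_coe_sq U
  -- `‖q − 1‖² = 2 − 2 re q` for the unit quaternion `su2Quat U` (the tree's `T4ExpWindowSmallField.norm_sub_one_sq`, inlined
  -- to keep this junction's import closure to the three files named above)
  have hR : ‖su2Quat U - 1‖ ^ 2 = 2 - 2 * (su2Quat U).re := by
    rw [@norm_sub_sq_real ℍ, norm_su2Quat U, norm_one, Quaternion.inner_def, star_one, mul_one]
    ring
  have hsq : ‖(U : Matrix (Fin 2) (Fin 2) ℂ) - 1‖ ^ 2 = ‖su2Quat U - 1‖ ^ 2 := by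
    rw [hL, hR, re_trace_su2_eq_two_mul_re]
  exact (sq_eq_sq₀ (norm_nonneg _) (norm_nonneg _)).mp hsq

/-- The same in `GaugeGroup` words: the tree's `SU(2)` instance and part 2's `sphereGaugeGroup` on `S³` give corresponding
elements the same `dist1`. -/
theorem dist1_eq_sphere_dist1 (U : Matrix.specialUnitaryGroup (Fin 2) ℂ) :
    dist1 U = sphereGaugeGroup.dist1 (su2SphereEquiv U) := by
  rw [dist1_eq_norm_su2SphereEquiv_sub_one, sphere_dist1_eq]

/-! ## §2 Wilson loops across the bridge: (NAS) is one inequality on both carriers -/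

/-- `toSphereConfig` commutes with straight-line holonomies. -/
theorem line_toSphereConfig (U : ZdGaugeConfig d (Matrix.specialUnitaryGroup (Fin 2) ℂ)) (k : Fin d) :
    ∀ (n : ℕ) (y : Fin d → ℤ),
      ZdGaugeConfig.line (toSphereConfig U) k n y = su2SphereEquiv (ZdGaugeConfig.line U k n y)
  | 0, y => by simp [ZdGaugeConfig.line]
  | n + 1, y => by rw [ZdGaugeConfig.line, ZdGaugeConfig.line, line_toSphereConfig U k n, map_mul]; rfl

/-- `toSphereConfig` commutes with rectangular Wilson loops. -/
theorem rectangle_toSphereConfig (U : ZdGaugeConfig d (Matrix.specialUnitaryGroup (Fin 2) ℂ)) (x : Fin d → ℤ)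
    (i j : Fin d) (R T : ℕ) :
    ZdGaugeConfig.rectangle (toSphereConfig U) x i j R T = su2SphereEquiv (ZdGaugeConfig.rectangle U x i j R T) := by
  simp only [ZdGaugeConfig.rectangle, line_toSphereConfig, map_mul, map_inv]

/-- The left side of (NAS) is the same number on both carriers. -/
theorem dist1_rectangle_eq_norm_toSphereConfig (U : ZdGaugeConfig d (Matrix.specialUnitaryGroup (Fin 2) ℂ))
    (x : Fin d → ℤ) (i j : Fin d) (R T : ℕ) :
    dist1 (ZdGaugeConfig.rectangle U x i j R T) =
      ‖((ZdGaugeConfig.rectangle (toSphereConfig U) x i j R T : Metric.sphere (0 : ℍ) 1) : ℍ) - 1‖ := by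
  rw [rectangle_toSphereConfig, dist1_eq_norm_su2SphereEquiv_sub_one]

/-- … and so is the right side, plaquette by plaquette. -/
theorem sum_dist1_plaquette_eq_sum_norm_toSphereConfig (U : ZdGaugeConfig d (Matrix.specialUnitaryGroup (Fin 2) ℂ))
    (x : Fin d → ℤ) (i j : Fin d) (R T : ℕ) :
    (∑ s ∈ Finset.range R, ∑ t ∈ Finset.range T,
        dist1 (ZdGaugeConfig.plaquette U (x + Pi.single i (s : ℤ) + Pi.single j (t : ℤ)) i j)) =
      ∑ s ∈ Finset.range R, ∑ t ∈ Finset.range T,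
        ‖((ZdGaugeConfig.plaquette (toSphereConfig U) (x + Pi.single i (s : ℤ) + Pi.single j (t : ℤ)) i j :
          Metric.sphere (0 : ℍ) 1) : ℍ) - 1‖ := by
  refine Finset.sum_congr rfl fun s _ => Finset.sum_congr rfl fun t _ => ?_
  rw [plaquette_toSphereConfig, dist1_eq_norm_su2SphereEquiv_sub_one]

/-- **(NAS) ON THE CELL'S `SU(2)` CARRIER** (instance resolution on part 2's `dist1_rectangle_le_sum`): for every
`U : ZdGaugeConfig d SU(2)`, `‖U(∂R_{R,T}) − 1‖ ≤ Σ_{s<R} Σ_{t<T} ‖U(∂p(x + s eᵢ + t eⱼ)) − 1‖` in the operator norm. -/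
theorem su2_dist1_rectangle_le_sum (U : ZdGaugeConfig d (Matrix.specialUnitaryGroup (Fin 2) ℂ)) (x : Fin d → ℤ)
    (i j : Fin d) (R T : ℕ) :
    dist1 (ZdGaugeConfig.rectangle U x i j R T) ≤ ∑ s ∈ Finset.range R, ∑ t ∈ Finset.range T,
      dist1 (ZdGaugeConfig.plaquette U (x + Pi.single i (s : ℤ) + Pi.single j (t : ℤ)) i j) :=
  dist1_rectangle_le_sum U x i j R T

end

end Summit.QuantumFields.BalabanUV.T4Continuum.NE7b.NonAbelianStokesSU2
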